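/-
# `Balaban1983to89.B5SupHolderTorus` — Bałaban CMP 95 (1984), Proposition 1.2, step S1 AS PRINTED on the torus of record:
# the elementary sup / HÖLDER CALCULUS of the norms (1.108)–(1.109) on the fine torus `T_η` behind the factor estimates
# (1.125), (1.129), (1.130) — lattice paths, the Leibniz rules with the multipliers `h_z`, products with cut-offs `ζ`

statement-level skeleton of published theorems with citation tags; proofs where landed; nothing here is a claim
about the Yang–Mills mass gap

CITATION HEADER (lean-in-tree rule).  Cell `lit-balaban`, unit `lit-balaban-p38` (Phase-2 proof seat p38 gen 8), HOME
`run/shared/lean/pub/lit-balaban/` (SKELETON rows B5.Eq1.109, B5.Eq1.121, B5.Eq1.125, B5.Eq1.129, B5.Prop1.2; owner r02).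
B5 = T. Bałaban, *Propagators and renormalization transformations for lattice gauge theories. I*, Commun. Math. Phys. **95**
(1984) 17–40 [`Balaban1984PropagatorsI`], held as `paper:balaban1984-cmp95-propagators-rt-i` (journal page = PDF page + 16).
FILE B of the p38-gen-8 half (DomCert side) of the sup/Hölder (S1) torus instantiation of `B5SupWalkS1.SupRealisation`
(B5-CLOSURE §5 item 2); FILE A = `B5SupCarrierTorus`.

WHAT IS PRINTED (verbatim, renders certified in `B5Prop12FieldsLattice` / `B5SupWalk125`).  p. 35 (1.108)–(1.109): «The most
fundamental are the supremum norm |A| = max_μ sup_x |A_μ(x)|, |∇A| = max_{μ,ν} sup_x |(∂_μA_ν)(x)|, (1.108) and the Hölder norm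
‖A‖_α = max_μ sup_{x,x′: |x−x′|≤1} |x − x′|^{−α}|A_μ(x) − A_μ(x′)|, … (1.109)».  p. 37 (1.121): «K(h)A = Σ_b (∂h)(b)(∂A)(b) −
(Δh)A + S*(∂h)QA − Q*S(∂h)A + P₁(∂h)A».  p. 38 (1.125): «For the first factor we have ‖ζ∇h_zGh_zA‖_α ≤ O(1)(‖ζ‖_α +
|ζ|)|h_zA|. (1.125)».  p. 38 (1.129): «|∇Gh_z∇*J| + |Gh_z∇*J| ≤ O(1)(‖J‖_ε + |J|) ≤ O(1)(‖J‖_{α+ε} + |J|). (1.129)».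

WHAT THIS MODULE PROVES (kernel-checked, zero sorry; real fields `v : Bnd n M → ℝ` on `T_η = Tor (fine n M)`, `η = 1/n`; the
typed norms are those of `B5Prop12FieldsLattice` at the embedded field `cplx v`):
§1 SUP-NORM PLUMBING: `|v_b| ≤ ‖v‖`, `|(∇_νv)(b)| ≤ ‖∇v‖` (`Dgs`/`gradR` with the sup norm of (1.108)), the one-step bound
   `|v(b + e_ν) − v(b)| ≤ η‖∇v‖`, and THE LATTICE-PATH LEMMA `|v(x′,μ) − v(x,μ)| ≤ d·|x − x′|·‖∇v‖` (`abs_sub_le_distU_mul`: walk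
   the centred representative `valMinAbs(x′ − x)` coordinate by coordinate) — whence `‖v‖_α ≤ d·|∇v|` on the pairs
   `|x − x′| ≤ 1` of (1.109) (`holderV_le_grad`), the lattice form of «Hölder from gradient»;
§2 THE MULTIPLIERS `h_z` IN SUP NORM (profile facts of p38-gen-7՚s `B5WalkH128Torus`/`B5WalkLeibnizTorus` by name: `∂h = O(M₀⁻¹)`,
   `∂∂h = O(M₀⁻²)`): `‖h_zv‖ ≤ ‖v‖`, `‖∇(h_zv)‖ ≤ ‖∇v‖ + (Lw/M₀)‖v‖` (`norm_gradR_gz_mul_le`), `‖E_z J‖ ≤ d(Lw/M₀)‖J‖` for the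
   divergence commutator `h_z∇*J = ∇*(h_zJ) + E_zJ` of `B5WalkLeibnizTorus.mul_divTR_eq` (`norm_Ediv_le`), `|Δ(h_zv)(b)| ≤ |(Δv)(b)| +
   2d(Lw/M₀)‖∇v‖ + d(K2/M₀²)‖v‖` (`abs_LapR_gz_mul_le`, from gen-7՚s `commR_axis_eq`), and the Hölder data of `∇h_z`:
   `‖∇(∇_νh_z)‖ ≤ Kmix/M₀²` (`norm_gradR_dgz_le`), `‖∇_νh_z‖_α ≤ d·Kmix/M₀²`;
§3 HÖLDER PLUMBING for (1.109): pair bounds from the seminorms (`abs_sub_le_holderV_mul`, `…holderT…`, `…holS…`), seminorm bounds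
   from pair bounds (`holderV_le_of_pairs`, `holderT_le_of_pairs`), MONOTONICITY IN THE EXPONENT on the pairs `|x − x′| ≤ 1`
   (`holderL_mono`: `‖J‖_ε ≤ ‖J‖_{ε′}` for `ε ≤ ε′` — the second inequality of (1.129)), the PRODUCT RULE AT A PAIR
   `|ζ(x′)F′ − ζ(x)F| ≤ |ζ(x′) − ζ(x)||F′| + |ζ(x)||F′ − F|`, and the product rule with the weight `h_z` at seminorm level
   `‖h_zJ‖_ε ≤ ‖J‖_ε + (Lw/M₀)|J|` for all three source kinds (`holderL_gz_mul_le`, from r02՚s `holderSeminormB5_mul_le`).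

HONEST SCOPE / DIVERGENCE.  (1) Pure lattice calculus: no statement of B5 is asserted; these are the «elementary» manipulations
the paper leaves implicit between (1.115)–(1.117) and (1.125)/(1.129)/(1.130) («The factors with G are estimated by using (1.115)»,
p. 38 [PDF 22 L5–6]).  (2) `|x − x′|` is the sup circular distance `distU` of `B5Prop12FieldsLattice` (reading note R2 there), so a lattice path
between the two sites has at most `d·n·|x − x′|` steps — the factor `d` in §1 is ours.  (3) Constants (`Lw`, `K2`, `Kmix` of gen 7)
explicit; `M₀ ≥ 1`, `η = 1/n ≤ 1`.  CELL BOOK-KEEPING (lit-balaban): rows B5.Eq1.109 (Hölder calculus on the torus of record),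
B5.Eq1.121 (sup-norm form of the local Leibniz data), B5.Eq1.125 / B5.Eq1.129 (their elementary inputs), B5.Prop1.2 (S1-torus
programme, p38 half, file B) — cells only, NO head change; value = plumbing for the printed route, NOT summit progress.
  v1.1 (p38 gen 9, DOCFIX ONLY — second-reader note r05 22-(b) = referee note ref-4 S-B5-g39-1): page numeral of
«The factors with G are estimated by using (1.115).» corrected p. 37 → p. 38 [PDF 22 L5–6] in this header (and «p. 37–38
(1.125)» → «p. 38 (1.125)»: the display and its lead-in «For the first factor we have» are p. 38 L6–7); declarations
byte-identical.
-/
import Mathlib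
import Literature.MathematicalPhysics.QuantumFieldTheory.Balaban1983to89.B5SupCarrierTorus
import Literature.MathematicalPhysics.QuantumFieldTheory.Balaban1983to89.B5WalkLeibnizTorus

open Finset

namespace Literature.MathematicalPhysics.QuantumFieldTheory.Balaban1983to89.B5SupHolderTorus

open scoped BigOperators Matrix
open Literature.MathematicalPhysics.QuantumFieldTheory.Balaban1983to89
open Literature.MathematicalPhysics.QuantumFieldTheory.Balaban1983to89.B5Prop11Plancherel (Tor fine unitVec)
open Literature.MathematicalPhysics.QuantumFieldTheory.Balaban1983to89.B5Prop12FieldsLattice (cdistF distU cubeT cubeB supNormL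
  holderL holderV holderT cutSupL cutHL distU_nonneg distU_self)
open Literature.MathematicalPhysics.QuantumFieldTheory.Balaban1983to89.B5RealFields (GR fdiffR gradR divTR LapR cplx)
open Literature.MathematicalPhysics.QuantumFieldTheory.Balaban1983to89.B5SettingP12Real (LocR VecR latticeSettingP12R)
open Literature.MathematicalPhysics.QuantumFieldTheory.Balaban1983to89.B5WalkTorusGeom (TorR ucPt Cen dist_ucPt_le_distU)
open Literature.MathematicalPhysics.QuantumFieldTheory.Balaban1983to89.B5WalkPartitionTorus (hz abs_hz_le_one abs_hz_sub_le)
open Literature.MathematicalPhysics.QuantumFieldTheory.Balaban1983to89.B5WalkCarrierTorus (Bnd)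
open Literature.MathematicalPhysics.QuantumFieldTheory.Balaban1983to89.B5CombesThomasLattice (nb distU_step_le)
open Literature.MathematicalPhysics.QuantumFieldTheory.Balaban1983to89.B5WalkH128Torus (pb nb_pb pb_nb gz abs_gz_le_one
  abs_gz_nb_sub_le abs_gz_pb_sub_le abs_gz_sub_le abs_gz_second_diff_le fdiffR_mulVec_apply fdiffR_transpose_mulVec_apply
  LapR_mulVec_apply commR commR_apply commR_sum commR_axis_eq LapR_eq_sum piece1 piece2 piece3 K2 K2_nonneg)
open Literature.MathematicalPhysics.QuantumFieldTheory.Balaban1983to89.B5WalkLeibnizTorus (gradR_mul_eq Ediv mul_divTR_eq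
  Kmix Kmix_nonneg abs_gz_mixed_le)
open Literature.MathematicalPhysics.QuantumFieldTheory.Balaban1983to89.B5CoverP12Lattice (Lw Lw_nonneg cdistF_le_mul_distU
  distU_comm)
open Literature.MathematicalPhysics.QuantumFieldTheory.Balaban1983to89.B5GlobCoverP12Lattice (holderSeminormB5_mul_le
  holderSeminormB5_cut_le)
open Literature.MathematicalPhysics.QuantumFieldTheory.Balaban1983to89.LatticeNorms (supNorm supNorm_le norm_le_supNorm
  supNorm_nonneg holderSeminorm holderSeminormB5 holderSeminorm_le holderSeminorm_nonneg holder_bound)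
open Literature.MathematicalPhysics.QuantumFieldTheory.Balaban1983to89.B5SupCarrierTorus (Dgs Dgs_apply)

noncomputable section

variable {d : ℕ}

/-! ## §1 Sup-norm plumbing and the lattice-path lemma -/

section SupPath

variable {n : ℕ} [NeZero n] {M : Fin d → ℕ} [hM : ∀ μ, NeZero (M μ)]

/-- `|v_b| ≤ ‖v‖` (the sup norm (1.108)). [cite: Balaban1984PropagatorsI, (1.108) p.35] -/
theorem abs_le_norm (v : VecR n M) (b : Bnd n M) : |v b| ≤ ‖v‖ :=
  B5SupCommutator128.abs_apply_le_norm v b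

/-- `|T_ν(b)| ≤ ‖T‖` for a tensor field (the sup norm (1.108)). [cite: Balaban1984PropagatorsI, (1.108) p.35] -/
theorem abs_le_norm_ten (T : Fin d → VecR n M) (ν : Fin d) (b : Bnd n M) : |T ν b| ≤ ‖T‖ :=
  (B5SupCommutator128.abs_apply_le_norm (T ν) b).trans (norm_le_pi_norm T ν)

/-- sup bound from a pointwise bound. [cite: Balaban1984PropagatorsI, (1.108) p.35] -/
theorem norm_le_of_forall_abs_le {v : VecR n M} {c : ℝ} (hc : 0 ≤ c) (h : ∀ b, |v b| ≤ c) : ‖v‖ ≤ c :=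
  (pi_norm_le_iff_of_nonneg hc).mpr fun b => by rw [Real.norm_eq_abs]; exact h b

/-- sup bound of a tensor field from a pointwise bound. [cite: Balaban1984PropagatorsI, (1.108) p.35] -/
theorem norm_ten_le_of_forall_abs_le {T : Fin d → VecR n M} {c : ℝ} (hc : 0 ≤ c) (h : ∀ ν b, |T ν b| ≤ c) : ‖T‖ ≤ c :=
  (pi_norm_le_iff_of_nonneg hc).mpr fun ν => norm_le_of_forall_abs_le hc (h ν)

/-- `|(∇_νv)(b)| ≤ |∇v|` (the sup norm of the gradient, (1.108)). [cite: Balaban1984PropagatorsI, (1.108) p.35] -/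
theorem abs_fdiffR_le (v : VecR n M) (ν : Fin d) (b : Bnd n M) : |(fdiffR n M ν *ᵥ v) b| ≤ ‖gradR n M v‖ :=
  abs_le_norm_ten (gradR n M v) ν b

/-- **one lattice step costs `η|∇v|`**: `|v(b + e_ν) − v(b)| ≤ (1/n)‖∇v‖`. [cite: Balaban1984PropagatorsI, (1.108)–(1.109) p.35] -/
theorem abs_sub_nb_le (v : VecR n M) (ν : Fin d) (b : Bnd n M) :
    |v (nb n M ν b) - v b| ≤ 1 / n * ‖gradR n M v‖ := by
  have hn : (0 : ℝ) < n := Nat.cast_pos.mpr (NeZero.pos n)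
  have h := abs_fdiffR_le v ν b
  rw [fdiffR_mulVec_apply, abs_mul, abs_of_pos hn] at h
  rw [div_mul_eq_mul_div, le_div_iff₀ hn, one_mul, mul_comm]
  exact h

/-- **walking `m` steps along one axis**: `|v(x + m e_ν, μ) − v(x, μ)| ≤ (m/n)‖∇v‖`. [cite: Balaban1984PropagatorsI, (1.109) p.35] -/
theorem abs_sub_nsmul_le (v : VecR n M) (ν μ : Fin d) (x : Tor (fine n M)) (m : ℕ) :
    |v (x + m • unitVec (fine n M) ν, μ) - v (x, μ)| ≤ (m : ℝ) / n * ‖gradR n M v‖ := by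
  induction m with
  | zero => simp
  | succ m ih =>
    have hstep := abs_sub_nb_le v ν (x + m • unitVec (fine n M) ν, μ)
    have e : nb n M ν (x + m • unitVec (fine n M) ν, μ) = (x + (m + 1) • unitVec (fine n M) ν, μ) := by
      simp only [nb, succ_nsmul, add_assoc]
    rw [e] at hstep
    calc |v (x + (m + 1) • unitVec (fine n M) ν, μ) - v (x, μ)|
        ≤ |v (x + (m + 1) • unitVec (fine n M) ν, μ) - v (x + m • unitVec (fine n M) ν, μ)|
          + |v (x + m • unitVec (fine n M) ν, μ) - v (x, μ)| := abs_sub_le _ _ _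
      _ ≤ 1 / n * ‖gradR n M v‖ + (m : ℝ) / n * ‖gradR n M v‖ := add_le_add hstep ih
      _ = ((m + 1 : ℕ) : ℝ) / n * ‖gradR n M v‖ := by push_cast; ring

/-- **walking `k ∈ ℤ` steps along one axis**: `|v(x + k e_ν, μ) − v(x, μ)| ≤ (|k|/n)‖∇v‖`. [cite: Balaban1984PropagatorsI, (1.109) p.35] -/
theorem abs_sub_zsmul_le (v : VecR n M) (ν μ : Fin d) (x : Tor (fine n M)) (k : ℤ) :
    |v (x + k • unitVec (fine n M) ν, μ) - v (x, μ)| ≤ ((k.natAbs : ℕ) : ℝ) / n * ‖gradR n M v‖ := by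
  obtain ⟨m, rfl | rfl⟩ := Int.eq_nat_or_neg k
  · rw [natCast_zsmul, Int.natAbs_natCast]
    exact abs_sub_nsmul_le v ν μ x m
  · rw [neg_zsmul, natCast_zsmul, Int.natAbs_neg, Int.natAbs_natCast]
    have h := abs_sub_nsmul_le v ν μ (x + -(m • unitVec (fine n M) ν)) m
    rw [neg_add_cancel_right] at h
    rwa [abs_sub_comm] at h

omit [NeZero n] hM in
/-- the centred integer displacement `k_ν = valMinAbs(x′_ν − x_ν)` recovers `x′ = x + Σ_ν k_ν e_ν` on the torus.
[cite: Balaban1984PropagatorsI, (1.109) p.35 (|x − x′|)] -/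
theorem add_sum_zsmul_unitVec_eq (x x' : Tor (fine n M)) :
    x + ∑ ν, ((x' ν - x ν).valMinAbs : ℤ) • unitVec (fine n M) ν = x' := by
  funext μ
  rw [Pi.add_apply, Finset.sum_apply]
  have h : ∀ ν, (((x' ν - x ν).valMinAbs : ℤ) • unitVec (fine n M) ν) μ
      = if ν = μ then ((x' μ - x μ).valMinAbs : ZMod (fine n M μ)) else 0 := by
    intro ν
    rw [Pi.smul_apply, unitVec]
    by_cases hνμ : ν = μ
    · subst hνμ
      rw [Pi.single_eq_same, if_pos rfl, zsmul_eq_mul, mul_one]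
    · rw [Pi.single_eq_of_ne (Ne.symm hνμ), smul_zero, if_neg hνμ]
  simp_rw [h]
  rw [Finset.sum_ite_eq' Finset.univ μ, if_pos (Finset.mem_univ μ), ZMod.coe_valMinAbs]
  abel

omit hM in
/-- `|k_ν| = cdistF(x′, x)_ν ≤ n·|x − x′|` for the centred displacement. [cite: Balaban1984PropagatorsI, (1.109) p.35 (|x − x′|)] -/
theorem natAbs_valMinAbs_le (x x' : Tor (fine n M)) (ν : Fin d) :
    (((x' ν - x ν).valMinAbs.natAbs : ℕ) : ℝ) ≤ n * distU n M x x' := by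
  have h := cdistF_le_mul_distU M n x' x ν
  rw [distU_comm] at h
  exact h

/-- **THE LATTICE-PATH LEMMA («Hölder from gradient» on `T_η`)**: `|v(x′, μ) − v(x, μ)| ≤ d·|x − x′|·|∇v|`, by walking the
centred representative of `x′ − x` one axis at a time (at most `n|x − x′|` steps per axis, each costing `η|∇v|`).
[cite: Balaban1984PropagatorsI, (1.108)–(1.109) p.35] -/
theorem abs_sub_le_distU_mul (v : VecR n M) (x x' : Tor (fine n M)) (μ : Fin d) :
    |v (x', μ) - v (x, μ)| ≤ d * distU n M x x' * ‖gradR n M v‖ := by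
  have hn : (0 : ℝ) < n := Nat.cast_pos.mpr (NeZero.pos n)
  set k : Fin d → ℤ := fun ν => (x' ν - x ν).valMinAbs with hk
  -- induction over the set of axes already walked
  have key : ∀ S : Finset (Fin d),
      |v (x + ∑ ν ∈ S, k ν • unitVec (fine n M) ν, μ) - v (x, μ)|
        ≤ (∑ ν ∈ S, ((k ν).natAbs : ℝ)) / n * ‖gradR n M v‖ := by
    intro S
    induction S using Finset.induction_on with
    | empty => simp
    | @insert a S ha ih =>
      rw [Finset.sum_insert ha, Finset.sum_insert ha, add_comm (k a • unitVec (fine n M) a), ← add_assoc]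
      have hstep := abs_sub_zsmul_le v a μ (x + ∑ ν ∈ S, k ν • unitVec (fine n M) ν) (k a)
      calc |v (x + ∑ ν ∈ S, k ν • unitVec (fine n M) ν + k a • unitVec (fine n M) a, μ) - v (x, μ)|
          ≤ |v (x + ∑ ν ∈ S, k ν • unitVec (fine n M) ν + k a • unitVec (fine n M) a, μ)
              - v (x + ∑ ν ∈ S, k ν • unitVec (fine n M) ν, μ)|
            + |v (x + ∑ ν ∈ S, k ν • unitVec (fine n M) ν, μ) - v (x, μ)| := abs_sub_le _ _ _
        _ ≤ ((k a).natAbs : ℝ) / n * ‖gradR n M v‖ + (∑ ν ∈ S, ((k ν).natAbs : ℝ)) / n * ‖gradR n M v‖ :=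
            add_le_add hstep ih
        _ = (((k a).natAbs : ℝ) + ∑ ν ∈ S, ((k ν).natAbs : ℝ)) / n * ‖gradR n M v‖ := by ring
  have h := key Finset.univ
  rw [hk, add_sum_zsmul_unitVec_eq] at h
  refine h.trans (mul_le_mul_of_nonneg_right ?_ (norm_nonneg _))
  rw [div_le_iff₀ hn]
  calc ∑ ν, (((x' ν - x ν).valMinAbs.natAbs : ℕ) : ℝ) ≤ ∑ _ν : Fin d, (n : ℝ) * distU n M x x' :=
        Finset.sum_le_sum fun ν _ => natAbs_valMinAbs_le x x' ν
    _ = d * distU n M x x' * n := by rw [Finset.sum_const, Finset.card_univ, Fintype.card_fin]; ring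

end SupPath

/-! ## §2 The multipliers `h_z` in sup norm: Leibniz bounds for `∇`, `∇*`, `Δ` and the Hölder data of `∇h_z` -/

section Multiplier

variable {n : ℕ} [NeZero n] {M : Fin d → ℕ} [hM : ∀ μ, NeZero (M μ)] {M₀ : ℕ}

omit [NeZero n] hM in
/-- FILE A՚s `hcoefS` is gen-7՚s `gz` (kept for the import-light file A). [cite: Balaban1984PropagatorsI, (1.118) p.36] -/
@[simp] theorem hcoefS_eq_gz (z : Cen M M₀) : B5SupCarrierTorus.hcoefS n M M₀ z = gz n M M₀ z := rfl

/-- **`‖h_zv‖ ≤ ‖v‖`** (`0 ≤ h_z ≤ 1`). [cite: Balaban1984PropagatorsI, (1.118) p.36] -/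
theorem norm_gz_mul_le (z : Cen M M₀) (v : VecR n M) : ‖(fun b => gz n M M₀ z b * v b : VecR n M)‖ ≤ ‖v‖ :=
  norm_le_of_forall_abs_le (norm_nonneg v) fun b => by
    rw [abs_mul]
    have h1 := abs_gz_le_one (n := n) z b
    have h2 := abs_le_norm v b
    have h0 := abs_nonneg (v b)
    nlinarith

/-- **`∂h = O(M₀⁻¹)` in sup form, forward**: `|n(h_z(b + e_ν) − h_z(b))| ≤ Lw/M₀`. [cite: Balaban1984PropagatorsI, (1.121) p.37, (1.128) p.38] -/
theorem abs_dgz_le (hn : 1 ≤ n) (hM₀ : 1 ≤ M₀) (z : Cen M M₀) (ν : Fin d) (b : Bnd n M) :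
    |(n : ℝ) * (gz n M M₀ z (nb n M ν b) - gz n M M₀ z b)| ≤ Lw d / M₀ := by
  have hnpos : (0 : ℝ) < n := Nat.cast_pos.mpr (NeZero.pos n)
  rw [abs_mul, abs_of_pos hnpos]
  calc (n : ℝ) * |gz n M M₀ z (nb n M ν b) - gz n M M₀ z b| ≤ n * (Lw d / M₀ * (1 / n)) :=
        mul_le_mul_of_nonneg_left (abs_gz_nb_sub_le hn hM₀ z ν b) hnpos.le
    _ = Lw d / M₀ := by field_simp

/-- **`∂h = O(M₀⁻¹)` in sup form, backward**: `|n(h_z(b − e_ν) − h_z(b))| ≤ Lw/M₀`. [cite: Balaban1984PropagatorsI, (1.121) p.37] -/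
theorem abs_dgz_pb_le (hn : 1 ≤ n) (hM₀ : 1 ≤ M₀) (z : Cen M M₀) (ν : Fin d) (b : Bnd n M) :
    |(n : ℝ) * (gz n M M₀ z (pb n M ν b) - gz n M M₀ z b)| ≤ Lw d / M₀ := by
  have hnpos : (0 : ℝ) < n := Nat.cast_pos.mpr (NeZero.pos n)
  rw [abs_mul, abs_of_pos hnpos]
  calc (n : ℝ) * |gz n M M₀ z (pb n M ν b) - gz n M M₀ z b| ≤ n * (Lw d / M₀ * (1 / n)) :=
        mul_le_mul_of_nonneg_left (abs_gz_pb_sub_le hn hM₀ z ν b) hnpos.le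
    _ = Lw d / M₀ := by field_simp

/-- **`‖∇(h_zv)‖ ≤ ‖∇v‖ + (Lw/M₀)‖v‖`** — the Leibniz rule `∇_ν(h v) = (τ_νh)∇_νv + (∇_νh)v` in sup norm (the input of the first
factor (1.125) and of «∂h = O(M₀⁻¹)»). [cite: Balaban1984PropagatorsI, (1.125) p.38, (1.121) p.37] -/
theorem norm_gradR_gz_mul_le (hn : 1 ≤ n) (hM₀ : 1 ≤ M₀) (z : Cen M M₀) (v : VecR n M) :
    ‖gradR n M (fun b => gz n M M₀ z b * v b)‖ ≤ ‖gradR n M v‖ + Lw d / M₀ * ‖v‖ := by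
  have hL : 0 ≤ Lw d / M₀ := div_nonneg (Lw_nonneg d) (Nat.cast_nonneg _)
  refine norm_ten_le_of_forall_abs_le (by positivity) fun ν b => ?_
  rw [gradR_mul_eq]
  simp only [Pi.add_apply]
  refine (abs_add_le _ _).trans (add_le_add ?_ ?_)
  · rw [abs_mul]
    have h1 := abs_gz_le_one (n := n) z (nb n M ν b)
    have h2 : |gradR n M v ν b| ≤ ‖gradR n M v‖ := abs_le_norm_ten _ ν b
    have h0 := abs_nonneg (gradR n M v ν b)
    nlinarith
  · rw [abs_mul]
    exact mul_le_mul (abs_dgz_le hn hM₀ z ν b) (abs_le_norm v b) (abs_nonneg _) hL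

/-- **the divergence commutator is small: `‖E_zJ‖ ≤ d(Lw/M₀)‖J‖`** for `h_z∇*J = ∇*(h_zJ) + E_zJ` (`B5WalkLeibnizTorus.mul_divTR_eq`).
[cite: Balaban1984PropagatorsI, (1.121) p.37, (1.129) p.38] -/
theorem norm_Ediv_le (hn : 1 ≤ n) (hM₀ : 1 ≤ M₀) (z : Cen M M₀) (J : Fin d → VecR n M) :
    ‖(Ediv (gz n M M₀ z) J : VecR n M)‖ ≤ d * (Lw d / M₀) * ‖J‖ := by
  have hL : 0 ≤ Lw d / M₀ := div_nonneg (Lw_nonneg d) (Nat.cast_nonneg _)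
  refine norm_le_of_forall_abs_le (by positivity) fun b => ?_
  rw [Ediv, Finset.sum_apply]
  calc |∑ ν, (n : ℝ) * (gz n M M₀ z b - gz n M M₀ z (pb n M ν b)) * J ν (pb n M ν b)|
      ≤ ∑ ν, |(n : ℝ) * (gz n M M₀ z b - gz n M M₀ z (pb n M ν b)) * J ν (pb n M ν b)| := Finset.abs_sum_le_sum_abs _ _
    _ ≤ ∑ _ν : Fin d, Lw d / M₀ * ‖J‖ := Finset.sum_le_sum fun ν _ => by
        rw [abs_mul]
        refine mul_le_mul ?_ (abs_le_norm_ten J ν _) (abs_nonneg _) hL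
        have h := abs_dgz_pb_le hn hM₀ z ν b
        rwa [← abs_neg, ← mul_neg, neg_sub] at h
    _ = d * (Lw d / M₀) * ‖J‖ := by rw [Finset.sum_const, Finset.card_univ, Fintype.card_fin]; ring

/-- **`Δ(h_zv)` in sup norm**: `|(Δ(h_zv))(b)| ≤ |(Δv)(b)| + 2d(Lw/M₀)‖∇v‖ + d(K2/M₀²)‖v‖`, from gen-7՚s decomposition
`[h_z, ∇_νᵀ∇_ν]v = (∇_νh)(∇_νv) + (∇_νᵀh)(∇_νᵀv) + (Δ_νh)v` (`commR_axis_eq`). [cite: Balaban1984PropagatorsI, (1.121) p.37 («(Δh)A»)] -/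
theorem abs_LapR_gz_mul_le (hn : 1 ≤ n) (hM₀ : 1 ≤ M₀) (z : Cen M M₀) (v : VecR n M) (b : Bnd n M) :
    |(LapR n M *ᵥ fun b' => gz n M M₀ z b' * v b') b|
      ≤ |(LapR n M *ᵥ v) b| + 2 * d * (Lw d / M₀) * ‖gradR n M v‖ + d * (K2 / (M₀ : ℝ) ^ 2) * ‖v‖ := by
  have hL : 0 ≤ Lw d / M₀ := div_nonneg (Lw_nonneg d) (Nat.cast_nonneg _)
  have hK : 0 ≤ K2 / (M₀ : ℝ) ^ 2 := div_nonneg K2_nonneg (sq_nonneg _)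
  have hn0 : (n : ℝ) ≠ 0 := Nat.cast_ne_zero.mpr (NeZero.ne n)
  -- `(Δ(hv))(b) = h(b)(Δv)(b) − [h, Δ]v(b)`
  have hcomm : (LapR n M *ᵥ fun b' => gz n M M₀ z b' * v b') b
      = gz n M M₀ z b * (LapR n M *ᵥ v) b - commR (gz n M M₀ z) (LapR n M) v b := by
    rw [commR_apply]; ring
  have hsum : commR (gz n M M₀ z) (LapR n M) v b
      = ∑ ν, (piece1 (gz n M M₀ z) v ν b + piece2 (gz n M M₀ z) v ν b + piece3 (gz n M M₀ z) v ν b) := by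
    rw [LapR_eq_sum, commR_sum, Finset.sum_apply]
    exact Finset.sum_congr rfl fun ν _ => by rw [commR_axis_eq]; rfl
  have h1 : ∀ ν, |piece1 (gz n M M₀ z) v ν b| ≤ Lw d / M₀ * ‖gradR n M v‖ := fun ν => by
    rw [piece1, abs_mul]
    exact mul_le_mul (abs_dgz_le hn hM₀ z ν b) (abs_fdiffR_le v ν b) (abs_nonneg _) hL
  have h2 : ∀ ν, |piece2 (gz n M M₀ z) v ν b| ≤ Lw d / M₀ * ‖gradR n M v‖ := fun ν => by
    rw [piece2, abs_mul]
    refine mul_le_mul (abs_dgz_pb_le hn hM₀ z ν b) ?_ (abs_nonneg _) hL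
    -- `(∇_νᵀv)(b) = −(∇_νv)(b − e_ν)`
    have e : ((fdiffR n M ν)ᵀ *ᵥ v) b = -((fdiffR n M ν *ᵥ v) (pb n M ν b)) := by
      rw [fdiffR_transpose_mulVec_apply, fdiffR_mulVec_apply, nb_pb]; ring
    rw [e, abs_neg]
    exact abs_fdiffR_le v ν _
  have h3 : ∀ ν, |piece3 (gz n M M₀ z) v ν b| ≤ K2 / (M₀ : ℝ) ^ 2 * ‖v‖ := fun ν => by
    rw [piece3, abs_mul]
    refine mul_le_mul ?_ (abs_le_norm v b) (abs_nonneg _) hK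
    rw [abs_mul, abs_of_nonneg (by positivity : (0 : ℝ) ≤ (n : ℝ) ^ 2)]
    calc (n : ℝ) ^ 2 * |gz n M M₀ z (nb n M ν b) - 2 * gz n M M₀ z b + gz n M M₀ z (pb n M ν b)|
        ≤ (n : ℝ) ^ 2 * (K2 / (M₀ : ℝ) ^ 2 * (1 / n) ^ 2) :=
          mul_le_mul_of_nonneg_left (abs_gz_second_diff_le hM₀ z ν b) (by positivity)
      _ = K2 / (M₀ : ℝ) ^ 2 := by field_simp
  have hc : |commR (gz n M M₀ z) (LapR n M) v b| ≤ 2 * d * (Lw d / M₀) * ‖gradR n M v‖ + d * (K2 / (M₀ : ℝ) ^ 2) * ‖v‖ := by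
    rw [hsum]
    refine (Finset.abs_sum_le_sum_abs _ _).trans ?_
    calc ∑ ν, |piece1 (gz n M M₀ z) v ν b + piece2 (gz n M M₀ z) v ν b + piece3 (gz n M M₀ z) v ν b|
        ≤ ∑ _ν : Fin d, (2 * (Lw d / M₀) * ‖gradR n M v‖ + K2 / (M₀ : ℝ) ^ 2 * ‖v‖) :=
          Finset.sum_le_sum fun ν _ => by
            have := h1 ν; have := h2 ν; have := h3 ν
            calc |piece1 (gz n M M₀ z) v ν b + piece2 (gz n M M₀ z) v ν b + piece3 (gz n M M₀ z) v ν b|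
                ≤ |piece1 (gz n M M₀ z) v ν b| + |piece2 (gz n M M₀ z) v ν b| + |piece3 (gz n M M₀ z) v ν b| :=
                  (abs_add_le _ _).trans (add_le_add (abs_add_le _ _) le_rfl)
              _ ≤ _ := by linarith
      _ = 2 * d * (Lw d / M₀) * ‖gradR n M v‖ + d * (K2 / (M₀ : ℝ) ^ 2) * ‖v‖ := by
          rw [Finset.sum_const, Finset.card_univ, Fintype.card_fin]; ring
  rw [hcomm]
  have hg := abs_gz_le_one (n := n) z b
  have hΔ := abs_nonneg ((LapR n M *ᵥ v) b)
  calc |gz n M M₀ z b * (LapR n M *ᵥ v) b - commR (gz n M M₀ z) (LapR n M) v b|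
      ≤ |gz n M M₀ z b * (LapR n M *ᵥ v) b| + |commR (gz n M M₀ z) (LapR n M) v b| := abs_sub _ _
    _ ≤ |(LapR n M *ᵥ v) b| + (2 * d * (Lw d / M₀) * ‖gradR n M v‖ + d * (K2 / (M₀ : ℝ) ^ 2) * ‖v‖) := by
        refine add_le_add ?_ hc
        rw [abs_mul]; nlinarith
    _ = _ := by ring

/-- the forward difference quotient of `h_z` along `e_ν`, as a (bond) field: `(∇_νh_z)(b) = n(h_z(b + e_ν) − h_z(b))`.
[cite: Balaban1984PropagatorsI, (1.121) p.37 («(∂h)(b)»)] -/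
def dgz (n : ℕ) (M : Fin d → ℕ) (M₀ : ℕ) (z : Cen M M₀) (ν : Fin d) : VecR n M :=
  fun b => (n : ℝ) * (gz n M M₀ z (nb n M ν b) - gz n M M₀ z b)

/-- `|∇_νh_z| ≤ Lw/M₀` in sup norm. [cite: Balaban1984PropagatorsI, (1.121) p.37, (1.128) p.38] -/
theorem norm_dgz_le (hn : 1 ≤ n) (hM₀ : 1 ≤ M₀) (z : Cen M M₀) (ν : Fin d) : ‖dgz n M M₀ z ν‖ ≤ Lw d / M₀ :=
  norm_le_of_forall_abs_le (div_nonneg (Lw_nonneg d) (Nat.cast_nonneg _)) fun b => abs_dgz_le hn hM₀ z ν b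

omit [NeZero n] hM in
/-- commuting lattice shifts: `b + e_μ + e_ν = b + e_ν + e_μ`. [cite: Balaban1984PropagatorsI, (1.31) p.23] -/
theorem nb_comm (μ ν : Fin d) (b : Bnd n M) : nb n M μ (nb n M ν b) = nb n M ν (nb n M μ b) := by
  obtain ⟨x, κ⟩ := b
  simp only [nb, add_assoc, add_comm (unitVec (fine n M) ν)]

/-- **`∂∂h = O(M₀⁻²)` in sup form: `‖∇(∇_νh_z)‖ ≤ Kmix/M₀²`** (axis and mixed second differences of gen 7՚s `abs_gz_mixed_le`).
[cite: Balaban1984PropagatorsI, (1.121) p.37 («Δh»)] -/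
theorem norm_gradR_dgz_le (hM₀ : 1 ≤ M₀) (z : Cen M M₀) (ν : Fin d) :
    ‖gradR n M (dgz n M M₀ z ν)‖ ≤ Kmix / (M₀ : ℝ) ^ 2 := by
  have hK : 0 ≤ Kmix / (M₀ : ℝ) ^ 2 := div_nonneg Kmix_nonneg (sq_nonneg _)
  have hnpos : (0 : ℝ) < n := Nat.cast_pos.mpr (NeZero.pos n)
  refine norm_ten_le_of_forall_abs_le hK fun μ b => ?_
  rw [gradR, fdiffR_mulVec_apply, dgz, dgz]
  have e : (n : ℝ) * ((n : ℝ) * (gz n M M₀ z (nb n M ν (nb n M μ b)) - gz n M M₀ z (nb n M μ b))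
        - (n : ℝ) * (gz n M M₀ z (nb n M ν b) - gz n M M₀ z b))
      = (n : ℝ) ^ 2 * (gz n M M₀ z (nb n M ν (nb n M μ b)) - gz n M M₀ z (nb n M μ b) - gz n M M₀ z (nb n M ν b)
          + gz n M M₀ z b) := by ring
  rw [e, abs_mul, abs_of_nonneg (by positivity : (0 : ℝ) ≤ (n : ℝ) ^ 2)]
  calc (n : ℝ) ^ 2 * |gz n M M₀ z (nb n M ν (nb n M μ b)) - gz n M M₀ z (nb n M μ b) - gz n M M₀ z (nb n M ν b)
        + gz n M M₀ z b|
      ≤ (n : ℝ) ^ 2 * (Kmix / (M₀ : ℝ) ^ 2 * (1 / n) ^ 2) :=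
        mul_le_mul_of_nonneg_left (abs_gz_mixed_le hM₀ z μ ν b) (by positivity)
    _ = Kmix / (M₀ : ℝ) ^ 2 := by field_simp

end Multiplier

/-! ## §3 Hölder plumbing for (1.109) -/

section Holder

variable {n : ℕ} [NeZero n] {M : Fin d → ℕ} [hM : ∀ μ, NeZero (M μ)] {M₀ : ℕ} {a : ℝ}

/-- the Hölder SEMINORM `‖ζ‖_α` of a real lattice function (pairs `|x − x′| ≤ 1`), so that `cutHL α ζ = holS α ζ + |ζ|`.
[cite: Balaban1984PropagatorsI, (1.109) p.35, Prop. 1.2 (1.111) p.35 (‖ζ‖_α + |ζ|)] -/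
def holS (n : ℕ) [NeZero n] (M : Fin d → ℕ) [∀ μ, NeZero (M μ)] (α : ℝ) (ζ : Tor (fine n M) → ℝ) : ℝ :=
  holderSeminormB5 α (fun _ _ : Tor (fine n M) => True) (distU n M) Finset.univ ζ

/-- `cutHL α ζ = ‖ζ‖_α + |ζ|`. [cite: Balaban1984PropagatorsI, Prop. 1.2 (1.111) p.35] -/
theorem cutHL_eq (α : ℝ) (ζ : Tor (fine n M) → ℝ) : cutHL n M α ζ = holS n M α ζ + cutSupL n M ζ := rfl

/-- `0 ≤ ‖ζ‖_α`. [cite: Balaban1984PropagatorsI, (1.109) p.35] -/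
theorem holS_nonneg (α : ℝ) (ζ : Tor (fine n M) → ℝ) : 0 ≤ holS n M α ζ := by
  unfold holS holderSeminormB5
  exact holderSeminorm_nonneg _ _ _ _ _ _

/-- `|ζ(x)| ≤ |ζ|`. [cite: Balaban1984PropagatorsI, Prop. 1.2 (1.114) p.36 (|ζ|)] -/
theorem abs_le_cutSupL (ζ : Tor (fine n M) → ℝ) (x : Tor (fine n M)) : |ζ x| ≤ cutSupL n M ζ := by
  have h := norm_le_supNorm ζ (Finset.mem_univ x)
  rwa [Real.norm_eq_abs] at h

/-- `0 ≤ |ζ|`. [cite: Balaban1984PropagatorsI, Prop. 1.2 (1.114) p.36] -/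
theorem cutSupL_nonneg' (ζ : Tor (fine n M) → ℝ) : 0 ≤ cutSupL n M ζ := supNorm_nonneg _ _

/-- **pair bound from `‖ζ‖_α`**: `|ζ(x′) − ζ(x)| ≤ ‖ζ‖_α|x − x′|^α` for `0 < |x − x′| ≤ 1`. [cite: Balaban1984PropagatorsI, (1.109) p.35] -/
theorem abs_sub_le_holS_mul (α : ℝ) (ζ : Tor (fine n M) → ℝ) {x x' : Tor (fine n M)} (h1 : distU n M x x' ≤ 1)
    (h0 : 0 < distU n M x x') : |ζ x' - ζ x| ≤ holS n M α ζ * distU n M x x' ^ α := by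
  have h := holder_bound (α := α) (adm := fun b b' : Tor (fine n M) => True ∧ distU n M b b' ≤ 1) (dist := distU n M)
    (τ := fun _ _ => id) (S := Finset.univ) ζ (Finset.mem_univ x) (Finset.mem_univ x') ⟨trivial, h1⟩ h0
  rwa [Real.norm_eq_abs] at h

/-- **pair bound from `‖v‖_α`** (vector field, same component): `|v(x′,μ) − v(x,μ)| ≤ ‖v‖_α|x − x′|^α` for `0 < |x − x′| ≤ 1`.
[cite: Balaban1984PropagatorsI, (1.109) p.35] -/
theorem abs_sub_le_holderV_mul (α : ℝ) (v : VecR n M) {x x' : Tor (fine n M)} (μ : Fin d) (h1 : distU n M x x' ≤ 1)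
    (h0 : 0 < distU n M x x') : |v (x', μ) - v (x, μ)| ≤ holderV n M α (cplx v) * distU n M x x' ^ α := by
  have h := holder_bound (α := α) (adm := fun b b' : Bnd n M => b.2 = b'.2 ∧ distU n M b.1 b'.1 ≤ 1)
    (dist := fun b b' => distU n M b.1 b'.1) (τ := fun _ _ => id) (S := Finset.univ) (cplx v)
    (Finset.mem_univ (x, μ)) (Finset.mem_univ (x', μ)) ⟨rfl, h1⟩ h0
  simp only [id, cplx, ← Complex.ofReal_sub, Complex.norm_real, Real.norm_eq_abs] at h
  exact h

/-- **pair bound from `‖T‖_α`** (tensor field, same indices): `|T_ν(x′,μ) − T_ν(x,μ)| ≤ ‖T‖_α|x − x′|^α` for `0 < |x − x′| ≤ 1`.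
[cite: Balaban1984PropagatorsI, (1.109) p.35] -/
theorem abs_sub_le_holderT_mul (α : ℝ) (T : Fin d → VecR n M) (ν : Fin d) {x x' : Tor (fine n M)} (μ : Fin d)
    (h1 : distU n M x x' ≤ 1) (h0 : 0 < distU n M x x') :
    |T ν (x', μ) - T ν (x, μ)| ≤ holderT n M α (fun ν => cplx (T ν)) * distU n M x x' ^ α := by
  have h := holder_bound (α := α)
    (adm := fun p p' : Fin d × Bnd n M => (p.1 = p'.1 ∧ p.2.2 = p'.2.2) ∧ distU n M p.2.1 p'.2.1 ≤ 1)
    (dist := fun p p' => distU n M p.2.1 p'.2.1) (τ := fun _ _ => id) (S := Finset.univ)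
    (fun p : Fin d × Bnd n M => cplx (T p.1) p.2)
    (Finset.mem_univ (ν, (x, μ))) (Finset.mem_univ (ν, (x', μ))) ⟨⟨rfl, rfl⟩, h1⟩ h0
  simp only [id, cplx, ← Complex.ofReal_sub, Complex.norm_real, Real.norm_eq_abs] at h
  exact h

/-- **`‖v‖_α` from pair bounds**: if `|v(x′,μ) − v(x,μ)| ≤ C|x − x′|^α` on all pairs `0 < |x − x′| ≤ 1` (`C ≥ 0`), then `‖v‖_α ≤ C`.
[cite: Balaban1984PropagatorsI, (1.109) p.35] -/
theorem holderV_le_of_pairs (α : ℝ) (v : VecR n M) {C : ℝ} (hC : 0 ≤ C)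
    (h : ∀ (x x' : Tor (fine n M)) (μ : Fin d), distU n M x x' ≤ 1 → 0 < distU n M x x' →
      |v (x', μ) - v (x, μ)| ≤ C * distU n M x x' ^ α) :
    holderV n M α (cplx v) ≤ C := by
  unfold holderV holderSeminormB5
  refine holderSeminorm_le hC fun b _ b' _ hadm hpos => ?_
  obtain ⟨hsd, hle1⟩ := hadm
  obtain ⟨x, μ⟩ := b
  obtain ⟨x', μ'⟩ := b'
  simp only at hsd hle1 hpos
  subst hsd
  simp only [id, cplx, ← Complex.ofReal_sub, Complex.norm_real, Real.norm_eq_abs]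
  exact h x x' μ hle1 hpos

/-- **`‖T‖_α` from pair bounds** (tensor field). [cite: Balaban1984PropagatorsI, (1.109) p.35] -/
theorem holderT_le_of_pairs (α : ℝ) (T : Fin d → VecR n M) {C : ℝ} (hC : 0 ≤ C)
    (h : ∀ (ν : Fin d) (x x' : Tor (fine n M)) (μ : Fin d), distU n M x x' ≤ 1 → 0 < distU n M x x' →
      |T ν (x', μ) - T ν (x, μ)| ≤ C * distU n M x x' ^ α) :
    holderT n M α (fun ν => cplx (T ν)) ≤ C := by
  unfold holderT holderSeminormB5
  refine holderSeminorm_le hC fun p _ p' _ hadm hpos => ?_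
  obtain ⟨⟨hν, hμ⟩, hle1⟩ := hadm
  obtain ⟨ν, x, μ⟩ := p
  obtain ⟨ν', x', μ'⟩ := p'
  simp only at hν hμ hle1 hpos
  subst hν; subst hμ
  simp only [id, cplx, ← Complex.ofReal_sub, Complex.norm_real, Real.norm_eq_abs]
  exact h ν x x' μ hle1 hpos

/-- `‖ζ‖_α` from pair bounds (scalar). [cite: Balaban1984PropagatorsI, (1.109) p.35] -/
theorem holS_le_of_pairs (α : ℝ) (ζ : Tor (fine n M) → ℝ) {C : ℝ} (hC : 0 ≤ C)
    (h : ∀ x x' : Tor (fine n M), distU n M x x' ≤ 1 → 0 < distU n M x x' → |ζ x' - ζ x| ≤ C * distU n M x x' ^ α) :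
    holS n M α ζ ≤ C := by
  unfold holS holderSeminormB5
  refine holderSeminorm_le hC fun x _ x' _ hadm hpos => ?_
  rw [id, Real.norm_eq_abs]
  exact h x x' hadm.2 hpos

/-- for `0 < t ≤ 1` and `s ≤ 1`: `t ≤ t^s`. [cite: Balaban1984PropagatorsI, (1.109) p.35 (pairs |x − x′| ≤ 1)] -/
theorem le_rpow_self_of_le_one {t s : ℝ} (ht0 : 0 < t) (ht1 : t ≤ 1) (hs : s ≤ 1) : t ≤ t ^ s := by
  have h := Real.rpow_le_rpow_of_exponent_ge ht0 ht1 hs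
  rwa [Real.rpow_one] at h

/-- **«Hölder from gradient» for (1.109): `‖v‖_α ≤ d·|∇v|`** (`α ≤ 1`; pairs `|x − x′| ≤ 1`), by the lattice-path lemma.
[cite: Balaban1984PropagatorsI, (1.108)–(1.109) p.35] -/
theorem holderV_le_grad (v : VecR n M) {α : ℝ} (hα : α ≤ 1) : holderV n M α (cplx v) ≤ d * ‖gradR n M v‖ := by
  refine holderV_le_of_pairs α v (by positivity) fun x x' μ h1 h0 => ?_
  calc |v (x', μ) - v (x, μ)| ≤ d * distU n M x x' * ‖gradR n M v‖ := abs_sub_le_distU_mul v x x' μ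
    _ ≤ d * distU n M x x' ^ α * ‖gradR n M v‖ := by
        gcongr
        exact le_rpow_self_of_le_one h0 h1 hα
    _ = d * ‖gradR n M v‖ * distU n M x x' ^ α := by ring

/-- `‖∇_νh_z‖_α ≤ d·Kmix/M₀²` (read `∇_νh_z` as a field constant in the component). [cite: Balaban1984PropagatorsI, (1.121) p.37, (1.109) p.35] -/
theorem holderV_dgz_le (hM₀ : 1 ≤ M₀) (z : Cen M M₀) (ν : Fin d) {α : ℝ} (hα : α ≤ 1) :
    holderV n M α (cplx (dgz n M M₀ z ν)) ≤ d * (Kmix / (M₀ : ℝ) ^ 2) :=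
  (holderV_le_grad _ hα).trans (mul_le_mul_of_nonneg_left (norm_gradR_dgz_le hM₀ z ν) (Nat.cast_nonneg _))

/-- **the product rule at a pair**: `|a′f′ − af| ≤ |a′ − a||f′| + |a||f′ − f|` (behind `‖ζF‖_α ≤ ‖ζ‖_α|F| + |ζ|‖F‖_α`).
[cite: Balaban1984PropagatorsI, (1.125) p.38 (the factor (‖ζ‖_α + |ζ|))] -/
theorem abs_mul_sub_mul_le (a a' f f' : ℝ) : |a' * f' - a * f| ≤ |a' - a| * |f'| + |a| * |f' - f| := by
  have e : a' * f' - a * f = (a' - a) * f' + a * (f' - f) := by ring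
  rw [e]
  exact (abs_add_le _ _).trans (by rw [abs_mul, abs_mul])

/-- **monotonicity of the Hölder seminorm in the exponent on the pairs `|x − x′| ≤ 1`** (generic): `ε ≤ ε′ ⇒ ‖f‖_ε ≤ ‖f‖_{ε′}` —
the second inequality of (1.129) «O(1)(‖J‖_ε + |J|) ≤ O(1)(‖J‖_{α+ε} + |J|)». [cite: Balaban1984PropagatorsI, (1.129) p.38, (1.109) p.35] -/
theorem holderSeminormB5_mono {ι : Type*} [Fintype ι] (sameDir : ι → ι → Prop) (dst : ι → ι → ℝ) (f : ι → ℂ)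
    {ε ε' : ℝ} (h : ε ≤ ε') :
    holderSeminormB5 ε sameDir dst Finset.univ f ≤ holderSeminormB5 ε' sameDir dst Finset.univ f := by
  set H := holderSeminormB5 ε' sameDir dst Finset.univ f with hH
  have hH0 : 0 ≤ H := holderSeminorm_nonneg _ _ _ _ _ _
  unfold holderSeminormB5
  refine holderSeminorm_le hH0 fun p _ p' _ hadm hpos => ?_
  have hb := holder_bound (α := ε') (adm := fun b b' => sameDir b b' ∧ dst b b' ≤ 1) (dist := dst) (τ := fun _ _ => id)
    (S := Finset.univ) f (Finset.mem_univ p) (Finset.mem_univ p') hadm hpos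
  refine hb.trans (mul_le_mul_of_nonneg_left ?_ hH0)
  exact Real.rpow_le_rpow_of_exponent_ge hpos hadm.2 h

/-- **`‖J‖_ε ≤ ‖J‖_{ε′}` for `ε ≤ ε′`** on the three source kinds of the setting of record. [cite: Balaban1984PropagatorsI, (1.129) p.38, (1.109) p.35] -/
theorem holderL_mono (J : LocR n M) {ε ε' : ℝ} (h : ε ≤ ε') : holderL n M ε J.emb ≤ holderL n M ε' J.emb := by
  cases J with
  | vec J =>
      show holderV n M ε (fun b => (J b : ℂ)) ≤ holderV n M ε' (fun b => (J b : ℂ))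
      unfold holderV
      exact holderSeminormB5_mono (fun b b' : Bnd n M => b.2 = b'.2) (fun b b' : Bnd n M => distU n M b.1 b'.1) _ h
  | ten J =>
      show holderT n M ε (fun s b => (J s b : ℂ)) ≤ holderT n M ε' (fun s b => (J s b : ℂ))
      unfold holderT
      exact holderSeminormB5_mono (fun p p' : Fin d × Bnd n M => p.1 = p'.1 ∧ p.2.2 = p'.2.2)
        (fun p p' : Fin d × Bnd n M => distU n M p.2.1 p'.2.1) _ h
  | ten2 J =>
      show B5Prop12FieldsLattice.holderT2 n M ε (fun s b => (J s b : ℂ)) ≤ B5Prop12FieldsLattice.holderT2 n M ε' (fun s b => (J s b : ℂ))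
      unfold B5Prop12FieldsLattice.holderT2
      exact holderSeminormB5_mono (fun p p' : (Fin d × Fin d) × Bnd n M => p.1 = p'.1 ∧ p.2.2 = p'.2.2)
        (fun p p' : (Fin d × Fin d) × Bnd n M => distU n M p.2.1 p'.2.1) _ h

/-- **`‖h_zv‖_ε ≤ ‖v‖_ε + (Lw/M₀)|v|`** (vector field; `ε ≤ 1`) — r02՚s unit-scale product rule `holderSeminormB5_mul_le` with the
weight `h_z ∈ [0, 1]`, `(Lw/M₀)`-Lipschitz in `|x − x′|`. [cite: Balaban1984PropagatorsI, (1.129) p.38, (1.109) p.35] -/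
theorem holderV_gz_mul_le (hn : 1 ≤ n) (hM₀ : 1 ≤ M₀) (z : Cen M M₀) (v : VecR n M) {ε : ℝ} (hε : ε ≤ 1) :
    holderV n M ε (cplx fun b => gz n M M₀ z b * v b) ≤ holderV n M ε (cplx v) + Lw d / M₀ * ‖v‖ := by
  have hL : 0 ≤ Lw d / M₀ := div_nonneg (Lw_nonneg d) (Nat.cast_nonneg _)
  have hlip : ∀ x x' : Tor (fine n M),
      |hz M M₀ z (ucPt M n x) - hz M M₀ z (ucPt M n x')| ≤ Lw d / M₀ * distU n M x x' :=
    fun x x' => (abs_hz_sub_le M hM₀ z _ _).trans (mul_le_mul_of_nonneg_left (dist_ucPt_le_distU M n hn _ _) hL)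
  have h := holderSeminormB5_mul_le (M := M) (n := n) (ι := Bnd n M) (fun b => b.1) (fun b b' => b.2 = b'.2)
    (fun x => hz M M₀ z (ucPt M n x)) hL (fun x => B5WalkPartitionTorus.hz_nonneg M M₀ z _)
    (fun x => B5WalkPartitionTorus.hz_le_one M M₀ z _) hlip (cplx v) hε
  have e1 : (fun p : Bnd n M => ((hz M M₀ z (ucPt M n p.1) : ℝ) : ℂ) * cplx v p) = cplx fun b => gz n M M₀ z b * v b := by
    funext p; simp [cplx, gz]
  rw [e1] at h
  exact h.trans (add_le_add le_rfl (mul_le_mul_of_nonneg_left (le_of_eq (B5SupCarrierTorus.supNorm_cplx_eq v)) hL))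

/-- **`‖h_zT‖_ε ≤ ‖T‖_ε + (Lw/M₀)|T|`** (tensor field; `ε ≤ 1`) — the input `‖h_zJ‖_ε` of (1.116)/(1.117) in (1.129)/(1.130).
[cite: Balaban1984PropagatorsI, (1.129) p.38, (1.109) p.35] -/
theorem holderT_gz_mul_le (hn : 1 ≤ n) (hM₀ : 1 ≤ M₀) (z : Cen M M₀) (T : Fin d → VecR n M) {ε : ℝ} (hε : ε ≤ 1) :
    holderT n M ε (fun ν => cplx fun b => gz n M M₀ z b * T ν b) ≤ holderT n M ε (fun ν => cplx (T ν)) + Lw d / M₀ * ‖T‖ := by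
  have hL : 0 ≤ Lw d / M₀ := div_nonneg (Lw_nonneg d) (Nat.cast_nonneg _)
  have hlip : ∀ x x' : Tor (fine n M),
      |hz M M₀ z (ucPt M n x) - hz M M₀ z (ucPt M n x')| ≤ Lw d / M₀ * distU n M x x' :=
    fun x x' => (abs_hz_sub_le M hM₀ z _ _).trans (mul_le_mul_of_nonneg_left (dist_ucPt_le_distU M n hn _ _) hL)
  have h := holderSeminormB5_mul_le (M := M) (n := n) (ι := Fin d × Bnd n M) (fun p => p.2.1)
    (fun p p' => p.1 = p'.1 ∧ p.2.2 = p'.2.2) (fun x => hz M M₀ z (ucPt M n x)) hL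
    (fun x => B5WalkPartitionTorus.hz_nonneg M M₀ z _) (fun x => B5WalkPartitionTorus.hz_le_one M M₀ z _) hlip
    (fun p : Fin d × Bnd n M => cplx (T p.1) p.2) hε
  have e1 : (fun p : Fin d × Bnd n M => ((hz M M₀ z (ucPt M n p.2.1) : ℝ) : ℂ) * cplx (T p.1) p.2)
      = fun p : Fin d × Bnd n M => cplx (fun b => gz n M M₀ z b * T p.1 b) p.2 := by
    funext p; simp [cplx, gz]
  rw [e1] at h
  exact h.trans (add_le_add le_rfl (mul_le_mul_of_nonneg_left (le_of_eq (B5SupCarrierTorus.supNorm_ten_cplx_eq T)) hL))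

/-- **`‖h_zJ‖_ε ≤ ‖J‖_ε + (Lw/M₀)|J|` for the real sources of record** (`vec`, `ten`; the `ten2` kind has no (1.110)–(1.113) entry and
the bound is the trivial `‖h_zJ‖_ε ≤ ‖h_zJ‖_ε`-free statement with the same right side). [cite: Balaban1984PropagatorsI, (1.129) p.38, (1.109) p.35] -/
theorem holderL_gz_mul_vec_le (hn : 1 ≤ n) (hM₀ : 1 ≤ M₀) (z : Cen M M₀) (k : ℕ) (v : VecR n M) {ε : ℝ} (hε : ε ≤ 1) :
    (latticeSettingP12R n M a k).holder ε (LocR.vec fun b => gz n M M₀ z b * v b)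
      ≤ (latticeSettingP12R n M a k).holder ε (LocR.vec v) + Lw d / M₀ * ‖v‖ :=
  holderV_gz_mul_le hn hM₀ z v hε

/-- the same for tensor sources. [cite: Balaban1984PropagatorsI, (1.129) p.38, (1.109) p.35] -/
theorem holderL_gz_mul_ten_le (hn : 1 ≤ n) (hM₀ : 1 ≤ M₀) (z : Cen M M₀) (k : ℕ) (T : Fin d → VecR n M) {ε : ℝ} (hε : ε ≤ 1) :
    (latticeSettingP12R n M a k).holder ε (LocR.ten fun ν b => gz n M M₀ z b * T ν b)
      ≤ (latticeSettingP12R n M a k).holder ε (LocR.ten T) + Lw d / M₀ * ‖T‖ :=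
  holderT_gz_mul_le hn hM₀ z T hε

end Holder

end

end Literature.MathematicalPhysics.QuantumFieldTheory.Balaban1983to89.B5SupHolderTorus
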